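import Summits.BirchSwinnertonDyer.BirchSwinnertonDyer.Theorems.EisensteinDepletionAtTwoStarPlusPrimitiveGlobal
import Literature.NumberTheory.EllipticCurves.RealLatticeRealLocusProofs
import HarnessLib

/-!
# Route `EisensteinDepletionAtTwo`, crux E1M `DepletedLambdaLawAtTwoMod` (stmt-BirchSwinnertonDyer-20341), line `star` v4.0:
# the ANALYTIC stub `stub_starPlusOddClass` — the plus parity is the Kummer parity of the odd half-period

Cell `bsd-rank2`, seat `bsd-rank2-eng-2` GEN 11 (the lead's KERNEL ASK of 2026-08-27T23:52:26Z); helper `--supports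
stmt-BirchSwinnertonDyer-20341`.  HONEST FRAMING: real-lattice bookkeeping (Mathlib `PeriodPair`, the tree's real-lattice files) and
the Eichler–Shimura normalisation `re Λ_f = ℤ·Ω⁺_f/2`; nothing here reads an analytic rank; (★-SymbGlobal)/(★)/E1M are NOT proved by
this file; BSD is not proved by any of this (PARTITION D-0054: none — r_an ≥ 2 axis S0, door T-r3₂).

## Statement (`star_plusOddClass` = the body of `…Cruxes.DepletedLambdaLawAtTwoMod.Star.StarPlusOddClass`, v4.0, with the skeleton's
## local `plusAt` / `EvenOnLoop` unfolded; the lead closes the registered stub by `fun … ↦ star_plusOddClass …`)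

For a globally minimal `W₀/ℚ` with newform `f`, a Néron pair `L₀` of `W₀/ℂ` (`g₂ = c₄/12`, `g₃ = c₆/216`) whose lattice is `q·Λ_f`
(both inclusions, `q ∈ ℚˣ`), and a rational `2`-torsion abscissa `x₀` of `W₀` which is ODD (least real root of `4r³ + b₂r² + 2b₄r + b₆`):
there is `λ ∈ Λ₀` with `λ/2 ∉ Λ₀`, `℘_{Λ₀}(λ/2) − b₂/12 = x₀`, such that for every cusp `b/d` (`d > 0`, `gcd(d, bN_W) = 1`) the plus
functional `[b/d]⁺_f − [0]⁺_f = n/2` has `n` EVEN iff `q·({∞,b/d}_f − {∞,0}_f) ∈ ℤλ + 2Λ₀`.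

## Proof

* `Λ₀` is a real lattice (`PeriodPair.isReal_of_g₂_g₃_real` + `uniformization_unique_holds`: real invariants).
* `λ := 2w`, `w = iΩ₀'/2` with `Ω₀'` the least positive real period of the real lattice `iΛ₀` (`IsReal.two_mul_halfPeriodI_mem`:
  `2w ∈ Λ₀`, `w ∉ Λ₀`).  `℘_{Λ₀}(w) = −℘_{iΛ₀}(Ω₀'/2) =: e'` is real (`weierstrassP_I_mul`, `IsReal.weierstrassP_ofReal_im`), a root of
  `f(x) = 4x³ − g₂x − g₃` (`IsReal.cubic_weierstrassPRe_half` for `iΛ₀`, `g₂(iΛ) = g₂`, `g₃(iΛ) = −g₃`) and `f < 0` on `(−∞, e')`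
  (`IsReal.cubic_neg_of_lt`): **`e'` is the least real root of `f`**.  Since `f(r + b₂/12) = 4r³ + b₂r² + 2b₄r + b₆` (`c₄ = b₂² − 24b₄`,
  `c₆ = −b₂³ + 36b₂b₄ − 216b₆`), `x₀ + b₂/12` is a real root of `f` (so `≥ e'`) and `e' − b₂/12` a real root of the `2`-division cubic
  (so `≥ x₀` by `TwoTorsionOdd`): `℘(λ/2) − b₂/12 = x₀`.
* `{∞,b/d} − {∞,0} ∈ Λ_f` (`modularSymbol_sub_zero_mem_periodLattice`, Manin), `re Λ_f = ℤ·Ω⁺_f/2` (`plusPeriod_pos_and_realPeriods_eq`),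
  `[r]⁺_f = re{∞,r}_f/Ω⁺_f` (`ratCast_ratPlusSymbol_holds`, `plusSymbol_eq_re_holds`): `[b/d]⁺ − [0]⁺ = n/2` with
  `re({∞,b/d} − {∞,0}) = n·Ω⁺_f/2`.
* For `μ ∈ Λ₀`: `μ ∈ ℤλ + 2Λ₀ ⟺ re μ ∈ 2·re Λ₀` — `re λ = 0`; conversely `μ − 2ν ∈ Λ₀ ∩ iℝ = ℤ·iΩ₀' = ℤλ`
  (`IsReal.exists_eq_int_mul` for `iΛ₀`) once `re ν = re μ/2`; and `re Λ₀ = q·ℤ·Ω⁺_f/2`.  Hence `q·M ∈ ℤλ + 2Λ₀ ⟺ n` even.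

References: J. H. Silverman, *AEC* VI.3.6, VI.5.1; *ATAEC* V.2 (real lattices); D. F. Lawden, *Elliptic Functions and Applications*
§§6.11–6.17 (rectangular/rhombic lattices, `e₃ = ℘(ω₂/2)` least); J. E. Cremona, *Algorithms* §2.8 (`re Λ_f = ℤΩ⁺/2`);
R. Greenberg, LNM 1716 §5 (odd `2`-torsion = minimal `x`).
-/

set_option linter.dupNamespace false
set_option autoImplicit false

noncomputable section

open scoped MatrixGroups ModularForm ComplexConjugate PeriodPair

open Complex CongruenceSubgroup Literature.NumberTheory.EllipticCurves Literature.NumberTheory.EllipticCurves.ModularForms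
  Literature.NumberTheory.EllipticCurves.Greenberg1999

namespace Summit.BirchSwinnertonDyer.BirchSwinnertonDyer.Theorems.DepletionAtTwo

/-! ### 1. The Néron lattice of a curve over `ℚ` is real -/

/-- A period pair with the invariants `g₂ = c₄/12`, `g₃ = c₆/216` of (the base change of) a curve over `ℚ` spans a REAL lattice
(stable under complex conjugation): uniqueness half of the Uniformization Theorem. [cite: SilvermanAEC2009, VI.5.1] -/
theorem isReal_of_isNeronLatticeOf_baseChange (W₀ : WeierstrassCurve ℚ) {L₀ : PeriodPair}
    (hL : IsNeronLatticeOf (W₀.baseChange ℂ) L₀) : L₀.IsReal := by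
  refine PeriodPair.isReal_of_g₂_g₃_real PeriodPair.uniformization_unique_holds ?_ ?_
  · rw [hL.1, WeierstrassCurve.baseChange, WeierstrassCurve.map_c₄, eq_ratCast, ← Complex.ofReal_ratCast,
      show ((12 : ℂ)) = ((12 : ℝ) : ℂ) by norm_num, ← Complex.ofReal_div, Complex.ofReal_im]
  · rw [hL.2, WeierstrassCurve.baseChange, WeierstrassCurve.map_c₆, eq_ratCast, ← Complex.ofReal_ratCast,
      show ((216 : ℂ)) = ((216 : ℝ) : ℂ) by norm_num, ← Complex.ofReal_div, Complex.ofReal_im]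

/-- Real parts of the invariants of a Néron pair: `re g₂ = c₄/12`, `re g₃ = c₆/216`. [cite: SilvermanAEC2009, VI.5.1] -/
theorem g₂_re_g₃_re_of_isNeronLatticeOf_baseChange (W₀ : WeierstrassCurve ℚ) {L₀ : PeriodPair}
    (hL : IsNeronLatticeOf (W₀.baseChange ℂ) L₀) :
    L₀.g₂.re = (W₀.c₄ : ℝ) / 12 ∧ L₀.g₃.re = (W₀.c₆ : ℝ) / 216 := by
  constructor
  · rw [hL.1, WeierstrassCurve.baseChange, WeierstrassCurve.map_c₄, eq_ratCast, ← Complex.ofReal_ratCast,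
      show ((12 : ℂ)) = ((12 : ℝ) : ℂ) by norm_num, ← Complex.ofReal_div, Complex.ofReal_re]
  · rw [hL.2, WeierstrassCurve.baseChange, WeierstrassCurve.map_c₆, eq_ratCast, ← Complex.ofReal_ratCast,
      show ((216 : ℂ)) = ((216 : ℝ) : ℂ) by norm_num, ← Complex.ofReal_div, Complex.ofReal_re]

/-! ### 2. The odd half-period `w = iΩ₀'/2`: `℘(w)` is the least real root of `4x³ − g₂x − g₃` -/

/-- For a real lattice `Λ` with rotated lattice `iΛ` (least positive real period `Ω₀'`): `℘_Λ(iΩ₀'/2) = −℘_{iΛ}(Ω₀'/2)` is the real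
number `e' := −re ℘_{iΛ}(Ω₀'/2)`. [cite: Lawden1989, §6.10 (6.10.14), §6.11] -/
theorem weierstrassP_halfPeriodI_eq {L : PeriodPair} (h : L.IsReal) :
    ℘[L] (I * (((L.mulLeft I I_ne_zero).minRealPeriod / 2 : ℝ) : ℂ)) =
      ((-(L.mulLeft I I_ne_zero).weierstrassPRe ((L.mulLeft I I_ne_zero).minRealPeriod / 2) : ℝ) : ℂ) := by
  rw [PeriodPair.weierstrassP_I_mul, Complex.ofReal_neg, neg_inj]
  apply Complex.ext
  · rw [Complex.ofReal_re]; rfl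
  · rw [Complex.ofReal_im]; exact h.mulLeft_I.weierstrassP_ofReal_im _

/-- `e' = ℘_Λ(iΩ₀'/2)` is a root of `4x³ − g₂x − g₃` (`℘'` vanishes at the half-period `Ω₀'/2` of `iΛ`, whose cubic is `−f(−x)`).
[cite: Lawden1989, §6.10 (6.10.13)–(6.10.14), §6.11] -/
theorem cubic_halfPeriodI_eq_zero {L : PeriodPair} (h : L.IsReal) :
    4 * (-(L.mulLeft I I_ne_zero).weierstrassPRe ((L.mulLeft I I_ne_zero).minRealPeriod / 2)) ^ 3 -
      L.g₂.re * (-(L.mulLeft I I_ne_zero).weierstrassPRe ((L.mulLeft I I_ne_zero).minRealPeriod / 2)) - L.g₃.re = 0 := by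
  have h1 := h.mulLeft_I.cubic_weierstrassPRe_half
  rw [PeriodPair.g₂_mulLeft_I, PeriodPair.g₃_mulLeft_I, Complex.neg_re] at h1
  linear_combination -h1

/-- **`e'` is the least real root**: every real root of `4x³ − g₂x − g₃` is `≥ e'` (`f < 0` to the left of `e'`).
[cite: Lawden1989, §6.11 (p. 170), §6.16] -/
theorem halfPeriodI_le_of_root {L : PeriodPair} (h : L.IsReal) {x : ℝ} (hx : 4 * x ^ 3 - L.g₂.re * x - L.g₃.re = 0) :
    -(L.mulLeft I I_ne_zero).weierstrassPRe ((L.mulLeft I I_ne_zero).minRealPeriod / 2) ≤ x := by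
  by_contra hlt
  have := h.cubic_neg_of_lt (not_le.mp hlt)
  linarith

/-! ### 3. The shift `x ↦ x + b₂/12` between the `2`-division cubic and `4x³ − g₂x − g₃` -/

/-- `4(r + b₂/12)³ − (c₄/12)(r + b₂/12) − c₆/216 = 4r³ + b₂r² + 2b₄r + b₆` (`c₄ = b₂² − 24b₄`, `c₆ = −b₂³ + 36b₂b₄ − 216b₆`).
[cite: SilvermanAEC2009, III.1] -/
theorem cubic_shift (W₀ : WeierstrassCurve ℚ) (r : ℝ) :
    4 * (r + (W₀.b₂ : ℝ) / 12) ^ 3 - (W₀.c₄ : ℝ) / 12 * (r + (W₀.b₂ : ℝ) / 12) - (W₀.c₆ : ℝ) / 216 =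
      4 * r ^ 3 + (W₀.b₂ : ℝ) * r ^ 2 + 2 * (W₀.b₄ : ℝ) * r + (W₀.b₆ : ℝ) := by
  simp only [WeierstrassCurve.c₄, WeierstrassCurve.c₆]
  push_cast
  ring

/-- **The odd rational `2`-torsion abscissa is `℘(w) − b₂/12`.**  For a Néron pair `L₀` of `W₀/ℂ` and a rational `2`-torsion abscissa
`x₀` which is the least real root of the `2`-division cubic: `x₀ + b₂/12 = e'`. [cite: GreenbergLNM1716, §5 Remark (chunk p0174)]
[cite: Lawden1989, §6.11, §6.16] -/
theorem ratCast_add_b₂_div_eq_halfPeriodI (W₀ : WeierstrassCurve ℚ) {L₀ : PeriodPair}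
    (hL : IsNeronLatticeOf (W₀.baseChange ℂ) L₀) {x₀ : ℚ} (hx : HasRationalTwoTorsionX W₀ x₀) (hodd : TwoTorsionOdd W₀ x₀) :
    (x₀ : ℝ) + (W₀.b₂ : ℝ) / 12 = -(L₀.mulLeft I I_ne_zero).weierstrassPRe ((L₀.mulLeft I I_ne_zero).minRealPeriod / 2) := by
  have hreal := isReal_of_isNeronLatticeOf_baseChange W₀ hL
  obtain ⟨h2, h3⟩ := g₂_re_g₃_re_of_isNeronLatticeOf_baseChange W₀ hL
  set e' := -(L₀.mulLeft I I_ne_zero).weierstrassPRe ((L₀.mulLeft I I_ne_zero).minRealPeriod / 2) with he'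
  obtain ⟨y, hxy, h2y⟩ := hx
  -- `x₀ + b₂/12` is a root of `f`
  have hroot : 4 * ((x₀ : ℝ) + (W₀.b₂ : ℝ) / 12) ^ 3 - L₀.g₂.re * ((x₀ : ℝ) + (W₀.b₂ : ℝ) / 12) - L₀.g₃.re = 0 := by
    rw [h2, h3, cubic_shift]
    exact fourXCubed_add_eq_zero_of_twoTorsion_real hxy h2y
  have h1 : e' ≤ (x₀ : ℝ) + (W₀.b₂ : ℝ) / 12 := halfPeriodI_le_of_root hreal hroot
  -- `e' − b₂/12` is a root of the `2`-division cubic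
  have hroot' : 4 * (e' - (W₀.b₂ : ℝ) / 12) ^ 3 + (W₀.b₂ : ℝ) * (e' - (W₀.b₂ : ℝ) / 12) ^ 2 +
      2 * (W₀.b₄ : ℝ) * (e' - (W₀.b₂ : ℝ) / 12) + (W₀.b₆ : ℝ) = 0 := by
    rw [← cubic_shift, sub_add_cancel, ← h2, ← h3]
    exact cubic_halfPeriodI_eq_zero hreal
  have h2' : (x₀ : ℝ) ≤ e' - (W₀.b₂ : ℝ) / 12 := hodd _ hroot'
  linarith

/-! ### 4. Purely imaginary lattice points are the multiples of `iΩ₀'` -/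

/-- For a real lattice `Λ`: a lattice point with real part `0` is an integer multiple of `iΩ₀' = 2w`. [cite: Lawden1989, §6.15] -/
theorem exists_eq_int_mul_I_of_re_eq_zero {L : PeriodPair} (h : L.IsReal) {z : ℂ} (hz : z ∈ L.lattice) (hre : z.re = 0) :
    ∃ k : ℤ, z = k * (2 * (I * (((L.mulLeft I I_ne_zero).minRealPeriod / 2 : ℝ) : ℂ))) := by
  set L' := L.mulLeft I I_ne_zero with hL'
  set t : ℝ := z.im with ht
  have hzI : z = (t : ℂ) * I := by
    apply Complex.ext <;> simp [ht, hre]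
  have hz' : (((-t : ℝ)) : ℂ) ∈ L'.lattice := by
    have : I * z = ((-t : ℝ) : ℂ) := by
      rw [hzI, Complex.ofReal_neg, mul_comm, mul_assoc, Complex.I_mul_I, mul_neg_one]
    rw [← this]
    exact PeriodPair.mul_mem_mulLeft_lattice.mpr hz
  obtain ⟨k, hk⟩ := h.mulLeft_I.exists_eq_int_mul hz'
  refine ⟨-k, ?_⟩
  have ht' : (t : ℂ) = -((k : ℂ) * (L'.minRealPeriod : ℂ)) := by
    have h1 : t = -(k * L'.minRealPeriod) := by linarith
    rw [h1]; push_cast; ring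
  rw [hzI, ht']
  push_cast
  ring

/-! ### 5. The theorem -/

/-- **(★-PlusOddClass) — the body of the registered stub `stub_starPlusOddClass` of line `star` v4.0** (with the skeleton's
`plusAt f b d = [b/d]⁺_f − [0]⁺_f` and `EvenOnLoop f q L₀ λ b d = «q·({∞,b/d}_f − {∞,0}_f) ∈ ℤλ + 2Λ₀»` unfolded): the plus parity on the
cusps `b/d`, `gcd(d, bN_W) = 1`, is the Kummer parity of the ODD half-period `λ/2 = iΩ₀'/2` of the Néron lattice `Λ₀ = q·Λ_f`, and
`℘(λ/2) − b₂/12` is the odd rational `2`-torsion abscissa.  The auxiliary curve `W` only carries the conductor in the coprimality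
condition (prime support of `N_W` = prime support of the level). [cite: CremonaAlgorithms1997, §2.8] [cite: Lawden1989, §§6.11–6.16]
[cite: GreenbergLNM1716, §5 (chunks p0168, p0174)] -/
theorem star_plusOddClass :
    ∀ (W : WeierstrassCurve ℚ) [W.IsElliptic] [W.IsGloballyMinimal] (W₀ : WeierstrassCurve ℚ) [W₀.IsElliptic]
      [W₀.IsGloballyMinimal] ⦃N : ℕ⦄ [NeZero N] (f : CuspForm (Gamma0 N) 2), IsNewformOf W f → IsNewformOf W₀ f →
    ∀ (L₀ : PeriodPair), IsNeronLatticeOf (W₀.baseChange ℂ) L₀ → ∀ (q : ℚ), q ≠ 0 →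
      (∀ z ∈ periodLattice f, (q : ℂ) * z ∈ L₀.lattice) → (∀ z ∈ L₀.lattice, ∃ w ∈ periodLattice f, z = (q : ℂ) * w) →
    ∀ (x₀ : ℚ), HasRationalTwoTorsionX W₀ x₀ → TwoTorsionOdd W₀ x₀ →
      ∃ lam : ℂ, lam ∈ L₀.lattice ∧ lam / 2 ∉ L₀.lattice ∧
        L₀.weierstrassP (lam / 2) - ((W₀.b₂ : ℚ) : ℂ) / 12 = ((x₀ : ℚ) : ℂ) ∧
        ∀ b d : ℤ, 0 < d → Int.gcd d (b * (W.conductorNorm ℤ : ℕ)) = 1 →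
          ∃ n : ℤ, ratPlusSymbol f ((b : ℚ) / (d : ℚ)) - ratPlusSymbol f 0 = n * (1 / 2 : ℚ) ∧
            (Even n ↔ ∃ k : ℤ, ∃ w ∈ L₀.lattice,
              (q : ℂ) * (modularSymbol f ((b : ℚ) / (d : ℚ)) - modularSymbol f 0) = (k : ℂ) * lam + 2 * w) := by
  intro W _ _ W₀ _ _ N _ f hfW hf₀ L₀ hL q hq hsub hsup x₀ hx hodd
  have hreal : L₀.IsReal := isReal_of_isNeronLatticeOf_baseChange W₀ hL
  set L' := L₀.mulLeft I I_ne_zero with hL'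
  set w : ℂ := I * (((L'.minRealPeriod / 2 : ℝ)) : ℂ) with hw
  obtain ⟨h2w, hw_not, -⟩ := hreal.two_mul_halfPeriodI_mem
  refine ⟨2 * w, h2w, by rwa [mul_div_cancel_left₀ _ (two_ne_zero' ℂ)], ?_, ?_⟩
  · -- `℘(w) − b₂/12 = x₀`
    rw [mul_div_cancel_left₀ _ (two_ne_zero' ℂ), weierstrassP_halfPeriodI_eq hreal,
      ← ratCast_add_b₂_div_eq_halfPeriodI W₀ hL hx hodd]
    push_cast
    ring
  · -- the parity statement on the cusps
    intro b d hd hcop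
    set M : ℕ := W.conductorNorm ℤ with hM
    have hQ := hfW.coeffField_eq_bot
    have hreal_f : ∀ n, (cuspCoeff f n).im = 0 := cuspCoeff_im_eq_zero_of_coeffField_eq_bot hQ
    obtain ⟨hpos, hre⟩ := plusPeriod_pos_and_realPeriods_eq (isZLattice_periodLattice_holds (f := f)) hfW.1 hQ
    set Ω := plusPeriod f with hΩ
    -- the cusp `b/d` has denominator prime to the level
    have hprime : ∀ p : ℕ, p.Prime → (p ∣ N ↔ p ∣ M) := fun p hp ↦ hfW.dvd_level_iff_dvd_conductorNorm hp
    have hx' : Nat.Coprime (((b : ℚ) / (d : ℚ))).den N := by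
      apply Nat.Coprime.symm
      apply Nat.coprime_of_dvd
      intro p hp hpN hpden
      have hpM : p ∣ M := (hprime p hp).mp hpN
      have hden : ((((b : ℚ) / (d : ℚ))).den : ℤ) ∣ d := by
        rw [← Rat.divInt_eq_div]; exact Rat.den_dvd b d
      have hpd : (p : ℤ) ∣ d := (Int.natCast_dvd_natCast.mpr hpden).trans hden
      have hpbM : (p : ℤ) ∣ b * (M : ℕ) := Dvd.dvd.mul_left (Int.natCast_dvd_natCast.mpr hpM) b
      have h1 : (p : ℤ) ∣ (Int.gcd d (b * (M : ℕ)) : ℤ) := Int.dvd_coe_gcd hpd hpbM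
      rw [hcop] at h1
      exact hp.one_lt.ne' (by exact_mod_cast Int.eq_one_of_dvd_one (by positivity) h1)
    -- `{∞,b/d} − {∞,0} ∈ Λ_f`, so its real part is `n·Ω/2`
    have hmem : modularSymbol f ((b : ℚ) / (d : ℚ)) - modularSymbol f 0 ∈ periodLattice f :=
      modularSymbol_sub_zero_mem_periodLattice f hx'
    obtain ⟨n, hn⟩ := exists_re_eq_add_of_sub_mem f hre hmem
    -- every `z ∈ Λ_f` has `re z = j·Ω/2`, and `Ω/2` is attained
    have hint : ∀ z ∈ periodLattice f, ∃ j : ℤ, z.re = j * (Ω / 2) := by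
      intro z hz
      have hz' : z.re ∈ realPeriods f := AddSubgroup.mem_map_of_mem _ hz
      rw [hre, AddSubgroup.mem_zmultiples_iff] at hz'
      obtain ⟨j, hj⟩ := hz'
      exact ⟨j, by rw [← hj, zsmul_eq_mul]⟩
    have hgen : ∃ z₁ ∈ periodLattice f, z₁.re = Ω / 2 := by
      have : Ω / 2 ∈ realPeriods f := by rw [hre]; exact AddSubgroup.mem_zmultiples _
      rw [realPeriods, AddSubgroup.mem_map] at this
      obtain ⟨z₁, hz₁, hz₁re⟩ := this
      exact ⟨z₁, hz₁, hz₁re⟩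
    refine ⟨n, ?_, ?_⟩
    · -- `[b/d]⁺ − [0]⁺ = n/2`
      have hΩ0 : Ω ≠ 0 := hpos.ne'
      apply Rat.cast_injective (α := ℝ)
      push_cast
      rw [ratCast_ratPlusSymbol_holds hfW.1 hQ ((b : ℚ) / (d : ℚ)), ratCast_ratPlusSymbol_holds hfW.1 hQ 0,
        normalizedPlusSymbol, normalizedPlusSymbol, plusSymbol_eq_re_holds f hreal_f, plusSymbol_eq_re_holds f hreal_f,
        Complex.ofReal_re, Complex.ofReal_re, hn, ← hΩ]
      field_simp
      ring
    · constructor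
      · -- `n` even ⇒ `qM ∈ ℤλ + 2Λ₀`
        rintro ⟨m, rfl⟩
        obtain ⟨z₁, hz₁, hz₁re⟩ := hgen
        -- `ν := q·m·z₁ ∈ Λ₀` has `re(qM − 2ν) = 0`
        have hν : (q : ℂ) * ((m : ℂ) * z₁) ∈ L₀.lattice := by
          have : (m : ℂ) * z₁ ∈ periodLattice f := by
            rw [← zsmul_eq_mul]; exact zsmul_mem hz₁ m
          exact hsub _ this
        have hdiff : (q : ℂ) * (modularSymbol f ((b : ℚ) / (d : ℚ)) - modularSymbol f 0) - 2 * ((q : ℂ) * ((m : ℂ) * z₁)) ∈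
            L₀.lattice := sub_mem (hsub _ hmem) (by rw [two_mul]; exact add_mem hν hν)
        have hre0 : ((q : ℂ) * (modularSymbol f ((b : ℚ) / (d : ℚ)) - modularSymbol f 0) -
            2 * ((q : ℂ) * ((m : ℂ) * z₁))).re = 0 := by
          have hMre : (modularSymbol f ((b : ℚ) / (d : ℚ)) - modularSymbol f 0).re = ((m : ℝ) + m) * (Ω / 2) := by
            rw [Complex.sub_re, hn]; push_cast; ring
          simp only [Complex.sub_re, Complex.mul_re, Complex.ratCast_re, Complex.ratCast_im, zero_mul, sub_zero,
            Complex.intCast_re, Complex.intCast_im, hMre, hz₁re, Complex.re_ofNat, Complex.im_ofNat]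
          ring
        obtain ⟨k, hk⟩ := exists_eq_int_mul_I_of_re_eq_zero hreal hdiff hre0
        refine ⟨k, (q : ℂ) * ((m : ℂ) * z₁), hν, ?_⟩
        rw [← hk]
        ring
      · -- `qM = kλ + 2ν` ⇒ `n` even
        rintro ⟨k, ν, hν, hk⟩
        obtain ⟨z, hz, rfl⟩ := hsup ν hν
        obtain ⟨j, hj⟩ := hint z hz
        have h1 := congr_arg Complex.re hk
        have hMre : (modularSymbol f ((b : ℚ) / (d : ℚ)) - modularSymbol f 0).re = n * (Ω / 2) := by
          rw [Complex.sub_re, hn]; ring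
        have hwre : w.re = 0 := by
          rw [hw, Complex.mul_re, Complex.I_re, Complex.I_im, Complex.ofReal_re, Complex.ofReal_im]; ring
        simp only [Complex.mul_re, Complex.ratCast_re, Complex.ratCast_im, zero_mul, sub_zero, hMre,
          Complex.add_re, Complex.intCast_re, Complex.intCast_im, Complex.re_ofNat, Complex.im_ofNat, hj, hwre,
          mul_zero] at h1
        -- `q n Ω/2 = 2 q j Ω/2`
        have h2 : (n : ℝ) = 2 * j := by
          have hqΩ : (q : ℝ) * (Ω / 2) ≠ 0 := mul_ne_zero (by exact_mod_cast hq) (by positivity)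
          apply mul_right_cancel₀ hqΩ
          linarith
        exact ⟨j, by exact_mod_cast (show (n : ℝ) = j + j by linarith)⟩

end Summit.BirchSwinnertonDyer.BirchSwinnertonDyer.Theorems.DepletionAtTwo

end
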